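import Mathlib
import Summits.Ventures.HodgeRepro.OcticCMPointEightModel

/-!
# OcticCMPointEightIdeal — the ideal `I = 𝔭⁴/𝔭⁸ = 5 R8` of the stationary phase on `𝒪/𝔭⁸`

Blind re-derivation cell `pub-hodge-repro`, seat night-2 (gen 5).  Target tree path
`lean/Summits/Ventures/HodgeRepro/OcticCMPointEightIdeal.lean`.  On the ring `R8 = 𝒪/𝔭⁸ = ℤ/25[w]/(w⁴ + 5w² + 5)`
of `OcticCMPointEightModel.lean`, the ideal `I = 5 R8 = 𝔭⁴/𝔭⁸` (`I5`) has exactly the properties the even-conductor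
theorem `GaussSumEvenConductor.LocalChar.eps_eq_of_primitive` / `eps_eq_of_conjDual` needs:

* `I · I = 0` (`I5_sq`: `25 = 0`) and `σ(I) ⊆ I` (`conj_mem_I5`);
* **the `ψ̃`-annihilator of `I` is `I`** (`psiAnn_I5_iff`): `ψ̃(x · 5b) = 1` for all `b` forces `5x = 0` by the
  primitivity of `ψ̃`, and `5x = 0` means every coordinate of `x` lies in `5ℤ/25` (`red5`, the coordinates mod `5`),
  i.e. `x ∈ 5 R8`;
* **`|I| = 625 = |R8|^{1/2}`** (`card_I5`): multiplication by `5` has kernel and range `I`, so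
  `|R8| = |R8/I| · |I| = |I|²` (`Nat.mul_self_inj`); hence `κ = 1/625` (`kappa_mul_card`).

**What this is not.**  The root numbers are in `OcticCMPointEightSign.lean`.  Nothing here says anything about the
status of the Hodge conjecture for CM abelian varieties, which is NOT proved.
-/

set_option autoImplicit false

noncomputable section

open Polynomial Classical

namespace Summit.Ventures.HodgeRepro.PeriodCloser

namespace EightModel

open GaussSumStability

/-! ### The ideal `I = 𝔭⁴/𝔭⁸ = 5 R8` -/

/-- **The ideal `I = 5 R8 = 𝔭⁴/𝔭⁸`** of the stationary phase. -/
def I5 : Ideal R8 := Ideal.span {(5 : R8)}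

/-- `y ∈ I ↔ y = 5b`. -/
theorem mem_I5_iff (y : R8) : y ∈ I5 ↔ ∃ b, y = 5 * b := by
  rw [I5, Ideal.mem_span_singleton']
  constructor
  · rintro ⟨b, hb⟩
    exact ⟨b, by rw [← hb, mul_comm]⟩
  · rintro ⟨b, hb⟩
    exact ⟨b, by rw [hb, mul_comm]⟩

/-- **`I · I = 0`** (`25 = 0`). -/
theorem I5_sq (z : R8) (hz : z ∈ I5) (z' : R8) (hz' : z' ∈ I5) : z * z' = 0 := by
  obtain ⟨b, rfl⟩ := (mem_I5_iff z).1 hz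
  obtain ⟨b', rfl⟩ := (mem_I5_iff z').1 hz'
  have h25 := twentyfive_eq_zero
  linear_combination (b * b') * h25

/-- `σ(I) ⊆ I`. -/
theorem conj_mem_I5 (z : R8) (hz : z ∈ I5) : conj z ∈ I5 := by
  obtain ⟨b, rfl⟩ := (mem_I5_iff z).1 hz
  rw [map_mul, map_ofNat]
  exact (mem_I5_iff _).2 ⟨conj b, rfl⟩

/-- The reduction `ℤ/25 → ℤ/5`. -/
def c5 : ZMod 25 →+* ZMod 5 := ZMod.castHom (by norm_num : 5 ∣ 25) (ZMod 5)

/-- The residue of `y` mod `5 R8`: the coordinates mod `5`. -/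
def red5 (y : R8) : Fin 4 → ZMod 5 := fun i => c5 (b4.repr y i)

/-- `c5 c = 0 → c = 5 d`. -/
theorem eq_five_mul_of_c5_eq_zero (c : ZMod 25) (h : c5 c = 0) : ∃ d : ZMod 25, c = 5 * d := by
  revert c; decide

/-- Residue `0` means `y = 5b`. -/
theorem eq_five_mul_of_red5_eq_zero {y : R8} (h : red5 y = 0) : ∃ b : R8, y = 5 * b := by
  choose d hd using fun i => eq_five_mul_of_c5_eq_zero (b4.repr y i) (congrFun h i)
  refine ⟨∑ i, d i • b4 i, ?_⟩
  conv_lhs => rw [← b4.sum_repr y]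
  rw [Finset.mul_sum]
  refine Finset.sum_congr rfl fun i _ => ?_
  rw [hd i, show (5 : R8) * (d i • b4 i) = ((5 : ZMod 25) * d i) • b4 i by
    rw [mul_smul, Algebra.smul_def (5 : ZMod 25), map_ofNat]]

/-- `5y = 0 → red5 y = 0`. -/
theorem red5_eq_zero_of_five_mul_eq_zero {y : R8} (h : 5 * y = 0) : red5 y = 0 := by
  funext i
  have h5 : (5 : R8) * y = (5 : ZMod 25) • y := by rw [Algebra.smul_def, map_ofNat]
  have h' : b4.repr ((5 : ZMod 25) • y) i = 0 := by
    rw [← h5, h, map_zero]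
    rfl
  rw [map_smul, Finsupp.coe_smul, Pi.smul_apply, smul_eq_mul] at h'
  have hc : ∀ c : ZMod 25, 5 * c = 0 → c5 c = 0 := by decide
  exact hc _ h'

/-- `red5 y = 0 → 5y = 0`. -/
theorem five_mul_eq_zero_of_red5_eq_zero {y : R8} (h : red5 y = 0) : 5 * y = 0 := by
  obtain ⟨b, rfl⟩ := eq_five_mul_of_red5_eq_zero h
  have h25 := twentyfive_eq_zero
  linear_combination b * h25

/-- `y ∈ I ↔ red5 y = 0`. -/
theorem mem_I5_iff_red5 (y : R8) : y ∈ I5 ↔ red5 y = 0 := by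
  rw [mem_I5_iff]
  constructor
  · rintro ⟨b, rfl⟩
    apply red5_eq_zero_of_five_mul_eq_zero
    have h25 := twentyfive_eq_zero
    linear_combination b * h25
  · exact eq_five_mul_of_red5_eq_zero

/-- **The `ψ̃`-annihilator of `I` is `I`** (the even-conductor shape): `ψ̃(x · 5b) = 1` for all `b` forces `5x = 0`
(primitivity), i.e. `x ∈ 5 R8`. -/
theorem psiAnn_I5_iff (x : R8) : PsiAnn psiTilde I5 x ↔ x ∈ I5 := by
  constructor
  · intro h
    have h5 : 5 * x = 0 := by
      by_contra hne
      apply psiTilde_isPrimitive hne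
      ext b
      rw [AddChar.mulShift_apply, AddChar.one_apply]
      have := h (5 * b) ((mem_I5_iff _).2 ⟨b, rfl⟩)
      rwa [show x * (5 * b) = 5 * x * b by ring] at this
    exact (mem_I5_iff_red5 x).2 (red5_eq_zero_of_five_mul_eq_zero h5)
  · intro hx z hz
    rw [I5_sq x hx z hz, AddChar.map_zero_eq_one]

/-! ### `|I| = 625` -/

/-- Multiplication by `5` as an additive map. -/
def mul5 : R8 →+ R8 := AddMonoidHom.mulLeft (5 : R8)

/-- `mul5 y = 5y`. -/
theorem mul5_apply (y : R8) : mul5 y = 5 * y := rfl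

/-- The range of `mul5` is `I`. -/
theorem mul5_range : mul5.range = I5.toAddSubgroup := by
  ext y
  rw [AddMonoidHom.mem_range, Submodule.mem_toAddSubgroup, mem_I5_iff]
  exact ⟨fun ⟨b, hb⟩ => ⟨b, hb.symm⟩, fun ⟨b, hb⟩ => ⟨b, hb.symm⟩⟩

/-- The kernel of `mul5` is `I`. -/
theorem mul5_ker : mul5.ker = I5.toAddSubgroup := by
  ext y
  rw [AddMonoidHom.mem_ker, Submodule.mem_toAddSubgroup, mem_I5_iff_red5, mul5_apply]
  exact ⟨red5_eq_zero_of_five_mul_eq_zero, five_mul_eq_zero_of_red5_eq_zero⟩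

/-- **`|I| = 625`**: `|R8| = |R8/ker| · |ker| = |I|²`. -/
theorem natCard_I5 : Nat.card I5 = 625 := by
  have h1 := AddSubgroup.card_eq_card_quotient_mul_card_addSubgroup mul5.ker
  have h2 : Nat.card (R8 ⧸ mul5.ker) = Nat.card mul5.range :=
    Nat.card_congr (QuotientAddGroup.quotientKerEquivRange mul5).toEquiv
  rw [h2, mul5_range, mul5_ker] at h1
  have h3 : Nat.card R8 = 625 * 625 := by rw [Nat.card_eq_fintype_card, card_R8]
  have h4 : Nat.card I5.toAddSubgroup = Nat.card I5 :=
    Nat.card_congr (Equiv.subtypeEquivRight fun x => Submodule.mem_toAddSubgroup I5)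
  rw [h4, h3] at h1
  exact Nat.mul_self_inj.1 h1.symm

/-- `|I| = 625 = |R8|^{1/2}`, so `κ = 1/625`. -/
theorem card_I5 : Fintype.card I5 = 625 := by
  rw [← Nat.card_eq_fintype_card, natCard_I5]

/-- `κ = 1/625` satisfies `κ |I| = 1`. -/
theorem kappa_mul_card : (1 / 625 : ℂ) * (Fintype.card I5 : ℂ) = 1 := by
  rw [card_I5]
  norm_num

end EightModel

end Summit.Ventures.HodgeRepro.PeriodCloser

end
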